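import Literature.IUT.HodgeTheaters.InitialThetaDataCuspNormaliserLaw
import Literature.IUT.HodgeTheaters.PiAvatarOrbitCategoryAut
import Literature.IUT.HodgeTheaters.PiAvatarBinding
import HarnessLib

/-!
# KIT-INSTANCE-SPEC P5-binding: the label action `gLabMap` of ALL of `Aut(𝒟^{⊚±})` on `GLab gModel = Cusp(X̲_K)`
# (defs — post-freeze additive D13, not a cone member), from the derived cusp action `actF` (G-L5t4g3-3,
# `InitialThetaDataCuspNormaliserLaw`) and `OrbitCat.autEquiv` (`PiAvatarOrbitCategoryAut`)

S. Mochizuki, *Inter-universal Teichmüller theory I*, kurims manuscript (May 2020), Def 6.1 (v) p. 158 («`Aut(𝒟^{⊚±})` … acts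
on the cusps of `X̲_K`»), (vi) p. 159 (`LabCusp^±(†𝒟^{⊚±})`, functorial in isomorphisms) ([IUTchI] Def 6.1 (v) p.158)
[claim: Mochizuki2012, status: disputed] (D-0012 claim key, series status DISPUTED — definitions over abc-iut-L5-t2's REAL
`InitialThetaData`, abc-iut-L5-t1's `CuspGalois`, under the HYPOTHESIS binder `hS : D.CuspClassesNormaliserStable`; nothing of the
series is asserted, no side is taken on [IUTchIII] Cor. 3.12).

WHAT IS BUILT.  `InitialThetaData.gLabAutModel CG hS : Aut (D.gModelObj) →* Equiv.Perm D.geom.pe.Cusp` — the kit slot `gLabMap` at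
the model object for AUTOMORPHISMS: `Aut(ℬ(Π_{X̲_K})⁰) ≅ N(Π_{X̲_K})/Π_{X̲_K}` (`OrbitCat.autEquiv`) followed by `actF` descended
modulo `Π_{X̲_K}` (`actF_eq_one_of_mem_PiXund`).  A MONOID HOM (so the kit laws `gLabMap_refl`/`gLabMap_trans` hold: `Aut`'s
multiplication and `Equiv.Perm`'s are both reversed composition).  Convention (forced by `autEquiv`: the class of `n` is
`xΠ ↦ xn⁻¹Π`): **`gLabAutModel (xΠ ↦ xmΠ) = (actF m)⁻¹`** (`gLabAutModel_autOfNormalizer`); for `c ∈ Π_{C̲_K}` this is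
`(CG.act c′)⁻¹ = CG.act c′⁻¹` with `embK c′ = c` (`gLabAutModel_autOfNormalizer_embK`), and for the `±` INVOLUTION (`c′² ∈ Π_X̲`)
literally `CG.act c′` — t13's (K2).  No instance/notation declared; typed ≠ proved elsewhere.
-/

noncomputable section

namespace Literature.IUT.HodgeTheaters

open CategoryTheory

universe u v w

section GlobalLabelAction

variable {F : Type u} {K : Type v} {Fbar : Type w} [Field F] [NumberField F] [Field K] [NumberField K]
  [Algebra F K] [Field Fbar] [Algebra F Fbar] [Algebra K Fbar]
  {E : WeierstrassCurve F} [E.IsElliptic] {l : ℕ} {Pb : BadPlacePredicates K}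
  (D : InitialThetaData F K Fbar E l Pb) (CG : D.geom.pe.CuspGalois) (hS : D.CuspClassesNormaliserStable)

namespace InitialThetaData

/-- `Π_{X̲_K} ∩ N(Π_{X̲_K})` lies in the kernel of `actF` (so `actF` descends to `Aut(𝒟^{⊚±}) = N/Π_{X̲_K}`).
([IUTchI] Def 6.1 (v) p.158) [claim: Mochizuki2012, status: disputed] -/
theorem subgroupOf_le_ker_actF :
    D.PiXund.subgroupOf (Subgroup.normalizer ((D.PiXund : Subgroup D.PiC) : Set D.PiC)) ≤ (D.actF CG hS).ker := by
  intro n hn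
  rw [MonoidHom.mem_ker]
  exact D.actF_eq_one_of_mem_PiXund CG hS n (Subgroup.mem_subgroupOf.mp hn)

/-- **Kit slot `gLabMap` at the model, on automorphisms: the action of `Aut(𝒟^{⊚±})` on `LabCusp^±(𝒟^{⊚±}) = Cusp(X̲_K)`**
(`autEquiv⁻¹` followed by `actF` descended modulo `Π_{X̲_K}`). ([IUTchI] Def 6.1 (v) p.158) [claim: Mochizuki2012, status: disputed] -/
def gLabAutModel : Aut (D.gModelObj) →* Equiv.Perm D.geom.pe.Cusp :=
  (QuotientGroup.lift _ (D.actF CG hS) (D.subgroupOf_le_ker_actF CG hS)).comp (OrbitCat.autEquiv D.PiXund).symm.toMonoidHom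

/-- **Convention**: on `xΠ_{X̲_K} ↦ xmΠ_{X̲_K}` the label action is `(actF m)⁻¹ = actF m⁻¹` (`autEquiv` sends the class of `n` to
`xΠ ↦ xn⁻¹Π`). ([IUTchI] Def 6.1 (v) p.158) [claim: Mochizuki2012, status: disputed] -/
theorem gLabAutModel_autOfNormalizer (m : D.PiC)
    (hm : m ∈ Subgroup.normalizer ((D.PiXund : Subgroup D.PiC) : Set D.PiC)) :
    D.gLabAutModel CG hS (OrbitCat.autOfNormalizer m hm) = (D.actF CG hS ⟨m, hm⟩)⁻¹ := by
  have h1 : (OrbitCat.autOfNormalizer m hm : Aut (D.gModelObj)) =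
      OrbitCat.autEquiv D.PiXund (QuotientGroup.mk ⟨m⁻¹, Subgroup.inv_mem _ hm⟩) := by
    rw [OrbitCat.autEquiv_mk, OrbitCat.autOfNormalizerHom_apply, OrbitCat.autOfNormalizer_eq_iff]
    simp
  have h2 : (OrbitCat.autEquiv D.PiXund).symm (OrbitCat.autOfNormalizer m hm) =
      QuotientGroup.mk ⟨m⁻¹, Subgroup.inv_mem _ hm⟩ := by
    rw [h1, MulEquiv.symm_apply_apply]
  have h3 : (⟨m⁻¹, Subgroup.inv_mem _ hm⟩ :
      ↥(Subgroup.normalizer ((D.PiXund : Subgroup D.PiC) : Set D.PiC))) = ⟨m, hm⟩⁻¹ := rfl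
  change QuotientGroup.lift _ (D.actF CG hS) (D.subgroupOf_le_ker_actF CG hS)
      ((OrbitCat.autEquiv D.PiXund).symm (OrbitCat.autOfNormalizer m hm)) = _
  rw [h2, QuotientGroup.lift_mk, h3, map_inv]

/-- On automorphisms induced by `c = embK c′ ∈ Π_{C_K}`: `gLabAutModel (xΠ ↦ xcΠ) = (CG.act c′)⁻¹ = CG.act c′⁻¹` (t1's action).
([IUTchI] Def 6.1 (v) p.158) [claim: Mochizuki2012, status: disputed] -/
theorem gLabAutModel_autOfNormalizer_embK (c' : D.geom.pe.PiC)
    (hm : D.geom.embK c' ∈ Subgroup.normalizer ((D.PiXund : Subgroup D.PiC) : Set D.PiC)) :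
    D.gLabAutModel CG hS (OrbitCat.autOfNormalizer (D.geom.embK c') hm) = CG.act c'⁻¹ := by
  rw [gLabAutModel_autOfNormalizer, D.actF_embK CG hS c' hm, map_inv]

/-- **(K2) for the `±` involution, literally**: if moreover `c′·c′ ∈ Π_X̲` (e.g. `c′ ∈ Π_C̲`, index `2`), then
`gLabAutModel (xΠ ↦ x·embK c′·Π) = CG.act c′`. ([IUTchI] Def 6.1 (v) p.158) [claim: Mochizuki2012, status: disputed] -/
theorem gLabAutModel_autOfNormalizer_embK_of_mul_self_mem (c' : D.geom.pe.PiC)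
    (hm : D.geom.embK c' ∈ Subgroup.normalizer ((D.PiXund : Subgroup D.PiC) : Set D.PiC))
    (h2 : c' * c' ∈ D.geom.pe.PiXbar) :
    D.gLabAutModel CG hS (OrbitCat.autOfNormalizer (D.geom.embK c') hm) = CG.act c' := by
  rw [gLabAutModel_autOfNormalizer_embK]
  -- `act (c′ c′) = 1` (elements of `Π_X̲` act trivially: `act_decomp` + `eq_of_conj`) `⇒ act c′⁻¹ = act c′`
  have h : CG.act (c' * c') = 1 := by
    ext x
    obtain ⟨t, ht, hEq⟩ := CG.act_decomp (c' * c') x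
    exact (CG.eq_of_conj x _ (t * (c' * c')) (D.geom.pe.PiXbar.mul_mem ht h2) hEq).symm
  rw [map_mul, mul_eq_one_iff_eq_inv, ← map_inv] at h
  rw [h]

/-- Automorphisms induced by `Π_{X̲_K}`-elements act trivially on the labels. ([IUTchI] Def 6.1 (v) p.158) [claim: Mochizuki2012, status: disputed] -/
theorem gLabAutModel_autOfNormalizer_eq_one_of_mem (m : D.PiC)
    (hm : m ∈ Subgroup.normalizer ((D.PiXund : Subgroup D.PiC) : Set D.PiC)) (hmX : m ∈ D.PiXund) :
    D.gLabAutModel CG hS (OrbitCat.autOfNormalizer m hm) = 1 := by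
  rw [gLabAutModel_autOfNormalizer, D.actF_eq_one_of_mem_PiXund CG hS ⟨m, hm⟩ hmX, inv_one]

end InitialThetaData

end GlobalLabelAction

end Literature.IUT.HodgeTheaters
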